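import Mathlib.Analysis.Calculus.MeanValue
import Mathlib.Analysis.Calculus.ContDiff.Defs
import Literature.Barriers.CriticalPhenomena.WeaklySAWFlowLinearised
import HarnessLib

/-!
# [BBS-rg-flow, §1.3 and Lemma 3.3 (first derivatives)]: the perturbation `(ψ, ρ)` — the domains
# `D_j` (1.10), Assumption (A3), Lipschitz consequences on `D_j`, and Lemma 1.3

Tenth file of the series formalising [BBS-rg-flow] (Bauerschmidt–Brydges–Slade, AHP 16 (2015),
arXiv:1211.2477), the abstract dynamical-system input of BBS 2015, Theorem 4.1 (via its Theorem 7.2.1),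
towards `Literature.Barriers.CriticalPhenomena.WeaklySAWFourDimLogCorrections`; continuation of
`WeaklySAWFlowLinearised.lean` (the derivative `Dφ̄_j = dmap` of the quadratic flow).

Contents:
* the quadratic remainder `Q_j(V̄; y) = φ̄_j(V̄+y) - φ̄_j(V̄) - Dφ̄_j(V̄)y` (`QuadFlowParams.quadRem`)
  with the EXACT midpoint rule `φ̄_j(a) - φ̄_j(b) = Dφ̄_j((a+b)/2)(a-b)` and the Lipschitz bound
  `‖Q_j(y) - Q_j(y')‖ ≤ M_j‖(y+y')/2‖‖y-y'‖`, `M_j = O(χ_j)` (the `D²Φ̄⁰` part of Lemmas 3.3/4.4);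
* the domains `D_j = D_j(g₀, a, h) ⊂ X_j = 𝒲_j ⊕ ℝ³` of (1.10) (`flowDomain`, for a general Banach
  space `𝒲_j`, weights `χ` and base flow `V̄` as arguments), their convexity and product structure;
* a directional mean value inequality on such sets (`norm_sub_le_of_fderivWithin_dir`): bounds on
  `‖Df(x)(k,0)‖` and `‖Df(x)(0,v)‖` separately give `‖f(x)-f(x')‖ ≤ C_K‖K-K'‖ + C_V‖V-V'‖`;
* **Assumption (A3)** as a hypothesis structure `HypA3 χ ψ ρ V̄ a h κ Ω R M` for families
  `ψ_j : 𝒲_j × ℝ³ → 𝒲_{j+1}`, `ρ_j : 𝒲_j × ℝ³ → ℝ³` over a sequence of real Banach spaces `𝒲_j`: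
  `C³` on `D_j`, `κ ∈ (0, Ω⁻¹)`, `R ∈ (0, a(1-κΩ))`, the bounds (1.11)–(1.13) with derivatives taken
  within `D_j` and operator norms rendered on pure directions (`pureDir`, `MixedDerivBound` for the
  orders `2 ≤ n+m ≤ 3`);
* its first consequences (the first-derivative part of Lemma 3.3, unscaled):
  `‖ψ_j(x) - ψ_j(x')‖ ≤ κ‖ΔK‖ + Mχ_{j+1}ḡ_{j+1}²‖ΔV‖`, `‖ρ_j(x) - ρ_j(x')‖ ≤ M‖ΔK‖ + Mχ_{j+1}ḡ_{j+1}²‖ΔV‖`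
  on `D_j`, `‖ψ_j(K,V)‖ ≤ Rχ_{j+1}ḡ_{j+1}³ + κ‖K‖`;
* the sequence `K̄` (`Kbar`: `K̄₀ = K₀`, `K̄_{j+1} = ψ_j(K̄_j, V̄_j)`) and **Lemma 1.3** in quantitative
  form (`HypA3.norm_Kbar_le`): with the one-step ratio `χ_jḡ_j³ ≤ ϑχ_{j+1}ḡ_{j+1}³` and
  `R + κa_*ϑ ≤ a_*`, `‖K₀‖ ≤ a_*χ₀ḡ₀³` implies `‖K̄_j‖ ≤ a_*χ_jḡ_j³` for all `j`.

Deliberately NOT here: the scaled (weighted-norm) form of Lemma 3.3 and the flow map `T` whose fixed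
points are the flows of Theorem 1.4 (next file); the second/third-derivative consequences (3.11).

## References
* R. Bauerschmidt, D. C. Brydges, G. Slade, *Structural stability of a dynamical system near a
  non-hyperbolic fixed point*, Ann. Henri Poincaré 16 (2015), arXiv:1211.2477: §1.3 (1.10)–(1.13),
  Assumption (A3), Lemma 1.3, §3.1 (3.3), Lemma 3.3 (3.10), §4.1 (4.2), Lemma 4.4 (proof).
  [BauerschmidtBrydgesSlade2015Flow]
* R. Bauerschmidt, D. C. Brydges, G. Slade, CMP 338 (2015), §7.2 (Assumption (A3), the domain `D_j`).
  [BauerschmidtBrydgesSlade2015LogCorr]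
-/

noncomputable section

open Filter Topology Set
open scoped BigOperators

namespace Literature.Barriers.CriticalPhenomena

namespace CTWSAW

/-! ## The perturbation `(ψ, ρ)`: domains `D_j` ((1.10)), Assumption (A3), and its Lipschitz
consequences (the first-derivative part of Lemma 3.3) -/

namespace QuadFlowParams

variable (P : QuadFlowParams) (j : ℕ)

/-- The midpoint rule is exact for the quadratic map `φ̄_j`:
`φ̄_j(a) - φ̄_j(b) = Dφ̄_j((a+b)/2)(a - b)`. [cite: BauerschmidtBrydgesSlade2015Flow, §4.1, (4.2) (φ̄_j is quadratic)] -/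
theorem map_sub_map_eq_dmap_midpoint (a b : V3) :
    P.map j a - P.map j b = P.dmap j ((1 / 2 : ℝ) • (a + b)) (a - b) := by
  ext i
  fin_cases i
  · simp [map]; ring
  · simp [map]; ring
  · simp [map]; ring

/-- The quadratic remainder `Q_j(V̄; y) = φ̄_j(V̄ + y) - φ̄_j(V̄) - Dφ̄_j(V̄)y` of the flow equation around a
base point. [cite: BauerschmidtBrydgesSlade2015Flow, §4.1, (4.2) and Lemma 4.4 (proof)] -/
def quadRem (Vb y : V3) : V3 := P.map j (Vb + y) - P.map j Vb - P.dmap j Vb y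

/-- `Q_j(y) - Q_j(y') = [Dφ̄_j(V̄ + (y+y')/2) - Dφ̄_j(V̄)](y - y')` (exact).
[cite: BauerschmidtBrydgesSlade2015Flow, §4.1, (4.2) and Lemma 4.4 (proof)] -/
theorem quadRem_sub_quadRem (Vb y y' : V3) :
    P.quadRem j Vb y - P.quadRem j Vb y' =
      (P.dmap j (Vb + (1 / 2 : ℝ) • (y + y')) - P.dmap j Vb) (y - y') := by
  have hmid := P.map_sub_map_eq_dmap_midpoint j (Vb + y) (Vb + y')
  have e1 : (1 / 2 : ℝ) • (Vb + y + (Vb + y')) = Vb + (1 / 2 : ℝ) • (y + y') := by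
    ext i; simp; ring
  have e2 : Vb + y - (Vb + y') = y - y' := by abel
  rw [e1, e2] at hmid
  calc P.quadRem j Vb y - P.quadRem j Vb y'
      = (P.map j (Vb + y) - P.map j (Vb + y')) - P.dmap j Vb (y - y') := by
        simp only [quadRem, map_sub]; abel
    _ = P.dmap j (Vb + (1 / 2 : ℝ) • (y + y')) (y - y') - P.dmap j Vb (y - y') := by rw [hmid]
    _ = _ := rfl

/-- **Lipschitz bound for the quadratic remainder**: `‖Q_j(y) - Q_j(y')‖ ≤ M_j‖(y+y')/2‖‖y - y'‖` with
`M_j = 2(|β_j| + |θ_j| + |ζ_j| + Σ|υ_j|) = O(χ_j)`. [cite: BauerschmidtBrydgesSlade2015Flow, Lemma 4.4 (proof) and Lemma 3.3, (3.11)] -/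
theorem norm_quadRem_sub_quadRem_le (Vb y y' : V3) :
    ‖P.quadRem j Vb y - P.quadRem j Vb y'‖ ≤
      (2 * |P.β j| + 2 * |P.θ j| + 2 * |P.ζ j| + 2 * |P.υgg j| + 2 * |P.υgz j| + 2 * |P.υgμ j| +
        2 * |P.υzz j| + 2 * |P.υzμ j|) * ‖(1 / 2 : ℝ) • (y + y')‖ * ‖y - y'‖ := by
  rw [P.quadRem_sub_quadRem]
  refine (ContinuousLinearMap.le_opNorm _ _).trans (mul_le_mul_of_nonneg_right ?_ (norm_nonneg _))
  have := P.norm_dmap_sub_dmap_le j Vb (Vb + (1 / 2 : ℝ) • (y + y'))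
  rwa [add_sub_cancel_left] at this

/-- `Q_j(0) = 0`. [cite: BauerschmidtBrydgesSlade2015Flow, §4.1] -/
@[simp] theorem quadRem_zero (Vb : V3) : P.quadRem j Vb 0 = 0 := by
  simp [quadRem]

end QuadFlowParams

section Perturbation

variable {E F : Type*} [NormedAddCommGroup E] [NormedSpace ℝ E] [NormedAddCommGroup F]
  [NormedSpace ℝ F]

/-- The domain `D_j = D_j(g₀, a, h) ⊂ X_j = 𝒲_j ⊕ 𝒱` of (1.10):
`‖K_j‖ ≤ aχ_jḡ_j³`, `|g_j - ḡ_j| ≤ hḡ_j²|log ḡ_j|`, `|z_j - z̄_j| ≤ hχ_jḡ_j²|log ḡ_j|`,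
`|μ_j - μ̄_j| ≤ hχ_jḡ_j²|log ḡ_j|`, where `V̄ = (ḡ, z̄, μ̄)` is the flow of Proposition 1.2 with
`ḡ₀ = g₀` (argument `Vb`) and `χ_j` the weights of (1.8) (argument `χ`); one scale `j`, `E = 𝒲_j`.
[cite: BauerschmidtBrydgesSlade2015Flow, §1.3, (1.10)] [cite: BauerschmidtBrydgesSlade2015LogCorr, §7.2 (the domain D_j)] -/
def flowDomain (χ : ℕ → ℝ) (Vb : ℕ → V3) (a hh : ℝ) (j : ℕ) : Set (E × V3) :=
  {x | ‖x.1‖ ≤ a * χ j * Vb j 0 ^ 3 ∧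
       |x.2 0 - Vb j 0| ≤ hh * Vb j 0 ^ 2 * |Real.log (Vb j 0)| ∧
       |x.2 1 - Vb j 1| ≤ hh * χ j * Vb j 0 ^ 2 * |Real.log (Vb j 0)| ∧
       |x.2 2 - Vb j 2| ≤ hh * χ j * Vb j 0 ^ 2 * |Real.log (Vb j 0)|}

omit [NormedSpace ℝ E] in
/-- Membership in `D_j`, unfolded. [cite: BauerschmidtBrydgesSlade2015Flow, §1.3, (1.10)] -/
theorem mem_flowDomain_iff (χ : ℕ → ℝ) (Vb : ℕ → V3) (a hh : ℝ) (j : ℕ) (x : E × V3) :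
    x ∈ flowDomain χ Vb a hh j ↔
      ‖x.1‖ ≤ a * χ j * Vb j 0 ^ 3 ∧
       |x.2 0 - Vb j 0| ≤ hh * Vb j 0 ^ 2 * |Real.log (Vb j 0)| ∧
       |x.2 1 - Vb j 1| ≤ hh * χ j * Vb j 0 ^ 2 * |Real.log (Vb j 0)| ∧
       |x.2 2 - Vb j 2| ≤ hh * χ j * Vb j 0 ^ 2 * |Real.log (Vb j 0)| := Iff.rfl

omit [NormedSpace ℝ E] in
/-- `D_j` is a product: the `𝒦`-coordinate of one point with the `𝒱`-coordinate of another stays in `D_j`.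
[cite: BauerschmidtBrydgesSlade2015Flow, §1.3, (1.10)] -/
theorem mixed_mem_flowDomain {χ : ℕ → ℝ} {Vb : ℕ → V3} {a hh : ℝ} {j : ℕ} {x x' : E × V3}
    (hx : x ∈ flowDomain χ Vb a hh j) (hx' : x' ∈ flowDomain χ Vb a hh j) :
    (x'.1, x.2) ∈ flowDomain χ Vb a hh j := ⟨hx'.1, hx.2⟩

/-- `D_j` is convex. [cite: BauerschmidtBrydgesSlade2015Flow, §1.3, (1.10)] -/
theorem convex_flowDomain (χ : ℕ → ℝ) (Vb : ℕ → V3) (a hh : ℝ) (j : ℕ) :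
    Convex ℝ (flowDomain (E := E) χ Vb a hh j) := by
  have h1 : Convex ℝ {x : E × V3 | ‖x.1‖ ≤ a * χ j * Vb j 0 ^ 3} := by
    simpa [Set.preimage, Metric.closedBall, dist_zero_right] using
      (convex_closedBall (0 : E) (a * χ j * Vb j 0 ^ 3)).linear_preimage (LinearMap.fst ℝ E V3)
  have hc : ∀ (i : Fin 3) (r : ℝ), Convex ℝ {x : E × V3 | |x.2 i - Vb j i| ≤ r} := fun i r => by
    have : Convex ℝ {t : ℝ | |t - Vb j i| ≤ r} := by
      simpa [Metric.closedBall, Real.dist_eq] using convex_closedBall (Vb j i) r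
    exact this.linear_preimage ((LinearMap.proj i).comp (LinearMap.snd ℝ E V3))
  simpa [flowDomain, Set.setOf_and] using h1.inter ((hc 0 _).inter ((hc 1 _).inter (hc 2 _)))

/-- The `𝒦`-slice `{K : (K, V) ∈ D_j}` is convex. [cite: BauerschmidtBrydgesSlade2015Flow, §1.3, (1.10)] -/
theorem convex_flowDomain_sliceK (χ : ℕ → ℝ) (Vb : ℕ → V3) (a hh : ℝ) (j : ℕ) (V : V3) :
    Convex ℝ {K : E | (K, V) ∈ flowDomain (E := E) χ Vb a hh j} :=
  (convex_flowDomain χ Vb a hh j).affine_preimage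
    ⟨fun K => (K, V), LinearMap.inl ℝ E V3, fun p v => by simp⟩

/-- The `𝒱`-slice `{V : (K, V) ∈ D_j}` is convex. [cite: BauerschmidtBrydgesSlade2015Flow, §1.3, (1.10)] -/
theorem convex_flowDomain_sliceV (χ : ℕ → ℝ) (Vb : ℕ → V3) (a hh : ℝ) (j : ℕ) (K : E) :
    Convex ℝ {V : V3 | (K, V) ∈ flowDomain (E := E) χ Vb a hh j} :=
  (convex_flowDomain χ Vb a hh j).affine_preimage
    ⟨fun V => (K, V), LinearMap.inr ℝ E V3, fun p v => by simp⟩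

/-- **Directional mean value inequality on `D_j`**: if `f` is differentiable within a product-like
convex set `D` with `‖D_Kf(x)k‖ ≤ C_K‖k‖` and `‖D_Vf(x)v‖ ≤ C_V‖v‖` on `D`, then
`‖f(x) - f(x')‖ ≤ C_K‖K - K'‖ + C_V‖V - V'‖` for `x, x' ∈ D` (through the corner `(K', V)`).
[cite: BauerschmidtBrydgesSlade2015Flow, Lemma 3.3 (proof of (3.10)) and Assumption (A3), (1.12)–(1.13)] -/
theorem norm_sub_le_of_fderivWithin_dir {D : Set (E × V3)}
    (hD : ∀ {x x' : E × V3}, x ∈ D → x' ∈ D → (x'.1, x.2) ∈ D)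
    (hK : ∀ V, Convex ℝ {K : E | (K, V) ∈ D}) (hV : ∀ K, Convex ℝ {V : V3 | (K, V) ∈ D})
    {f : E × V3 → F} (hf : DifferentiableOn ℝ f D) {CK CV : ℝ} (hCK0 : 0 ≤ CK) (hCV0 : 0 ≤ CV)
    (hCK : ∀ x ∈ D, ∀ k : E, ‖fderivWithin ℝ f D x (k, 0)‖ ≤ CK * ‖k‖)
    (hCV : ∀ x ∈ D, ∀ v : V3, ‖fderivWithin ℝ f D x (0, v)‖ ≤ CV * ‖v‖)
    {x x' : E × V3} (hx : x ∈ D) (hx' : x' ∈ D) :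
    ‖f x - f x'‖ ≤ CK * ‖x.1 - x'.1‖ + CV * ‖x.2 - x'.2‖ := by
  have hm : (x'.1, x.2) ∈ D := hD hx hx'
  -- the `𝒦`-segment from `(K', V)` to `x = (K, V)`
  have h1 : ‖f x - f (x'.1, x.2)‖ ≤ CK * ‖x.1 - x'.1‖ := by
    have hg : ∀ K ∈ {K : E | (K, x.2) ∈ D}, HasFDerivWithinAt (fun K : E => f (K, x.2))
        ((fderivWithin ℝ f D (K, x.2)).comp (ContinuousLinearMap.inl ℝ E V3)) {K : E | (K, x.2) ∈ D} K :=
      fun K hKm => (hf (K, x.2) hKm).hasFDerivWithinAt.comp K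
        (hasFDerivAt_prodMk_left (𝕜 := ℝ) K x.2).hasFDerivWithinAt fun K' hK' => hK'
    have hb : ∀ K ∈ {K : E | (K, x.2) ∈ D},
        ‖(fderivWithin ℝ f D (K, x.2)).comp (ContinuousLinearMap.inl ℝ E V3)‖ ≤ CK := fun K hKm =>
      ContinuousLinearMap.opNorm_le_bound _ hCK0 fun k => by simpa using hCK (K, x.2) hKm k
    have hxs : x.1 ∈ {K : E | (K, x.2) ∈ D} := hx
    simpa using (hK x.2).norm_image_sub_le_of_norm_hasFDerivWithin_le hg hb hm hxs
  -- the `𝒱`-segment from `x' = (K', V')` to `(K', V)`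
  have h2 : ‖f (x'.1, x.2) - f x'‖ ≤ CV * ‖x.2 - x'.2‖ := by
    have hg : ∀ V ∈ {V : V3 | (x'.1, V) ∈ D}, HasFDerivWithinAt (fun V : V3 => f (x'.1, V))
        ((fderivWithin ℝ f D (x'.1, V)).comp (ContinuousLinearMap.inr ℝ E V3)) {V : V3 | (x'.1, V) ∈ D} V :=
      fun V hVm => (hf (x'.1, V) hVm).hasFDerivWithinAt.comp V
        (hasFDerivAt_prodMk_right (𝕜 := ℝ) x'.1 V).hasFDerivWithinAt fun V' hV' => hV'
    have hb : ∀ V ∈ {V : V3 | (x'.1, V) ∈ D},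
        ‖(fderivWithin ℝ f D (x'.1, V)).comp (ContinuousLinearMap.inr ℝ E V3)‖ ≤ CV := fun V hVm =>
      ContinuousLinearMap.opNorm_le_bound _ hCV0 fun v => by simpa using hCV (x'.1, V) hVm v
    have hxs : x'.2 ∈ {V : V3 | (x'.1, V) ∈ D} := hx'
    simpa using (hV x'.1).norm_image_sub_le_of_norm_hasFDerivWithin_le hg hb hxs hm
  calc ‖f x - f x'‖ = ‖(f x - f (x'.1, x.2)) + (f (x'.1, x.2) - f x')‖ := by rw [sub_add_sub_cancel]
    _ ≤ ‖f x - f (x'.1, x.2)‖ + ‖f (x'.1, x.2) - f x'‖ := norm_add_le _ _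
    _ ≤ _ := add_le_add h1 h2

end Perturbation


/-! ## Assumption (A3) and its first consequences: Lipschitz bounds for `ψ_j, ρ_j` on `D_j`
(Lemma 3.3, first-derivative part) and Lemma 1.3 (`K̄` stays in the `a_*`-domain) -/

section KbarDef

variable {W : ℕ → Type*}

/-- The sequence `K̄`: `K̄₀ = K₀`, `K̄_{j+1} = ψ_j(K̄_j, V̄_j)` (Lemma 1.3 and (3.3)); with `V̄` this is the
flow `x̄ = (K̄, V̄)` of `Φ̄ = (ψ, φ̄)`. [cite: BauerschmidtBrydgesSlade2015Flow, Lemma 1.3 and §3.1, (3.3)] -/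
def Kbar (ψ : ∀ j, W j × V3 → W (j + 1)) (Vb : ℕ → V3) (K₀ : W 0) : ∀ j, W j
  | 0 => K₀
  | j + 1 => ψ j (Kbar ψ Vb K₀ j, Vb j)

/-- `K̄₀ = K₀`. [cite: BauerschmidtBrydgesSlade2015Flow, §3.1, (3.3)] -/
@[simp] theorem Kbar_zero (ψ : ∀ j, W j × V3 → W (j + 1)) (Vb : ℕ → V3) (K₀ : W 0) :
    Kbar ψ Vb K₀ 0 = K₀ := rfl

/-- `K̄_{j+1} = ψ_j(K̄_j, V̄_j)`. [cite: BauerschmidtBrydgesSlade2015Flow, §3.1, (3.3)] -/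
theorem Kbar_succ (ψ : ∀ j, W j × V3 → W (j + 1)) (Vb : ℕ → V3) (K₀ : W 0) (j : ℕ) :
    Kbar ψ Vb K₀ (j + 1) = ψ j (Kbar ψ Vb K₀ j, Vb j) := rfl

end KbarDef

section PerturbationA3

variable {E F : Type*} [NormedAddCommGroup E] [NormedSpace ℝ E] [NormedAddCommGroup F]
  [NormedSpace ℝ F]

omit [NormedSpace ℝ E] in
/-- The point `(0, V̄_j)` lies in `D_j` when `a, h, χ_j, ḡ_j ≥ 0`. [cite: BauerschmidtBrydgesSlade2015Flow, §1.3, (1.10)] -/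
theorem zero_flow_mem_flowDomain {χ : ℕ → ℝ} {Vb : ℕ → V3} {a hh : ℝ} (ha : 0 ≤ a) (hh0 : 0 ≤ hh)
    (hχ : ∀ j, 0 ≤ χ j) (hg : ∀ j, 0 ≤ Vb j 0) (j : ℕ) :
    ((0 : E), Vb j) ∈ flowDomain χ Vb a hh j := by
  simp only [mem_flowDomain_iff, norm_zero, sub_self, abs_zero]
  exact ⟨by have := hχ j; have := hg j; positivity, by have := hg j; positivity,
    by have := hχ j; have := hg j; positivity, by have := hχ j; have := hg j; positivity⟩

omit [NormedSpace ℝ E] in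
/-- `D_j` is monotone in the `𝒦`-radius parameter `a`. [cite: BauerschmidtBrydgesSlade2015Flow, §1.3, (1.10)] -/
theorem flowDomain_mono {χ : ℕ → ℝ} {Vb : ℕ → V3} {a a' hh : ℝ} (haa : a ≤ a') (hχ : ∀ j, 0 ≤ χ j)
    (hg : ∀ j, 0 ≤ Vb j 0) (j : ℕ) : flowDomain (E := E) χ Vb a hh j ⊆ flowDomain χ Vb a' hh j := by
  intro x hx
  refine ⟨hx.1.trans ?_, hx.2⟩
  have := hχ j; have := hg j
  gcongr

/-- A pure direction in `X_j = 𝒲_j ⊕ 𝒱`: `(k, 0)` (a `K`-direction, `τ = true`) or `(0, v)`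
(a `V`-direction, `τ = false`); used to express the norms of the mixed derivatives `D_V^m D_K^n φ_j`.
[cite: BauerschmidtBrydgesSlade2015Flow, Assumption (A3), (1.13)] -/
def pureDir (τ : Bool) (k : E) (v : V3) : E × V3 := if τ then (k, 0) else (0, v)

/-- The bound (1.13) on the mixed derivatives of `φ = φ_j : D_j → F` at `x ∈ D_j`: for `2 ≤ n + m ≤ 3`,
`‖D_V^m D_K^n φ(x)‖_{L^{n+m}(X_j, X_{j+1})} ≤ M A^{1-n} Bq^{-m}` (`A = χ_{j+1}ḡ_{j+1}³`,
`Bq = ḡ_{j+1}²|log ḡ_{j+1}|`), rendered on the within-`D` iterated Fréchet derivative evaluated at pure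
directions (`n` = number of `K`-slots, `m` = number of `V`-slots, in any order).
[cite: BauerschmidtBrydgesSlade2015Flow, Assumption (A3), (1.13)] -/
def MixedDerivBound (φ : E × V3 → F) (D : Set (E × V3)) (x : E × V3) (M A Bq : ℝ) : Prop :=
  ∀ n : ℕ, 2 ≤ n → n ≤ 3 → ∀ (τ : Fin n → Bool) (k : Fin n → E) (v : Fin n → V3),
    ‖iteratedFDerivWithin ℝ n φ D x (fun i => pureDir (τ i) (k i) (v i))‖ ≤
      M * A ^ (1 - ((Finset.univ.filter fun i => τ i = true).card : ℤ)) *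
        Bq ^ (-((Finset.univ.filter fun i => τ i = false).card : ℤ)) *
        ∏ i, (if τ i then ‖k i‖ else ‖v i‖)

end PerturbationA3

section SystemA3

variable {W : ℕ → Type*} [∀ j, NormedAddCommGroup (W j)] [∀ j, NormedSpace ℝ (W j)]

/-- **Assumption (A3)** (the perturbation) for maps `ψ_j : X_j → 𝒲_{j+1}`, `ρ_j : X_j → 𝒱` (total
functions; only their restrictions to `D_j = flowDomain χ V̄ a h j` matter), the weights `χ` and the flow
`V̄` of Proposition 1.2 defining `D_j`, with parameters `(a, h, κ, Ω, R, M)`: `ψ_j, ρ_j` are `C³` on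
`D_j`; `κ ∈ (0, Ω⁻¹)`, `R ∈ (0, a(1-κΩ))`, `M > 0`; and for all `x_j ∈ D_j`:
(1.11) `‖ψ_j(0, V_j)‖ ≤ Rχ_{j+1}ḡ_{j+1}³`, `‖ρ_j(x_j)‖ ≤ Mχ_{j+1}ḡ_{j+1}³`;
(1.12) `‖D_Kψ_j(x_j)‖ ≤ κ`, `‖D_Kρ_j(x_j)‖ ≤ M`;
(1.13) for `φ = ψ, ρ`: `‖D_Vφ_j(x_j)‖ ≤ Mχ_{j+1}ḡ_{j+1}²` and
`‖D_V^mD_K^nφ_j(x_j)‖ ≤ M(χ_{j+1}ḡ_{j+1}³)^{1-n}(ḡ_{j+1}²|log ḡ_{j+1}|)^{-m}`, `2 ≤ n+m ≤ 3`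
(derivatives within `D_j`; operator norms rendered on pure directions).
[cite: BauerschmidtBrydgesSlade2015Flow, Assumption (A3), (1.11)–(1.13)]
[cite: BauerschmidtBrydgesSlade2015LogCorr, §7.2, Assumption (A3)] -/
structure HypA3 (χ : ℕ → ℝ) (ψ : ∀ j, W j × V3 → W (j + 1)) (ρ : ∀ j, W j × V3 → V3) (Vb : ℕ → V3)
    (a hh κ Ω R M : ℝ) : Prop where
  /-- `κ > 0`. -/
  κ_pos : 0 < κ
  /-- `κ < Ω⁻¹`. -/
  κ_lt : κ < Ω⁻¹
  /-- `R > 0`. -/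
  R_pos : 0 < R
  /-- `R < a(1 - κΩ)`. -/
  R_lt : R < a * (1 - κ * Ω)
  /-- `M > 0`. -/
  M_pos : 0 < M
  /-- `ψ_j` is `C³` on `D_j`. -/
  contDiffOn_ψ : ∀ j, ContDiffOn ℝ 3 (ψ j) (flowDomain χ Vb a hh j)
  /-- `ρ_j` is `C³` on `D_j`. -/
  contDiffOn_ρ : ∀ j, ContDiffOn ℝ 3 (ρ j) (flowDomain χ Vb a hh j)
  /-- (1.11): `‖ψ_j(0, V_j)‖ ≤ Rχ_{j+1}ḡ_{j+1}³`. -/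
  ψ_zero_le : ∀ j, ∀ x ∈ flowDomain (E := W j) χ Vb a hh j,
    ‖ψ j (0, x.2)‖ ≤ R * χ (j + 1) * Vb (j + 1) 0 ^ 3
  /-- (1.11): `‖ρ_j(x_j)‖ ≤ Mχ_{j+1}ḡ_{j+1}³`. -/
  ρ_le : ∀ j, ∀ x ∈ flowDomain χ Vb a hh j, ‖ρ j x‖ ≤ M * χ (j + 1) * Vb (j + 1) 0 ^ 3
  /-- (1.12): `‖D_Kψ_j(x_j)‖_{L(𝒲_j,𝒲_{j+1})} ≤ κ`. -/
  dK_ψ_le : ∀ j, ∀ x ∈ flowDomain χ Vb a hh j, ∀ k : W j,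
    ‖fderivWithin ℝ (ψ j) (flowDomain χ Vb a hh j) x (k, 0)‖ ≤ κ * ‖k‖
  /-- (1.12): `‖D_Kρ_j(x_j)‖_{L(𝒲_j,𝒱)} ≤ M`. -/
  dK_ρ_le : ∀ j, ∀ x ∈ flowDomain χ Vb a hh j, ∀ k : W j,
    ‖fderivWithin ℝ (ρ j) (flowDomain χ Vb a hh j) x (k, 0)‖ ≤ M * ‖k‖
  /-- (1.13): `‖D_Vψ_j(x_j)‖_{L(𝒱,X_{j+1})} ≤ Mχ_{j+1}ḡ_{j+1}²`. -/
  dV_ψ_le : ∀ j, ∀ x ∈ flowDomain χ Vb a hh j, ∀ v : V3,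
    ‖fderivWithin ℝ (ψ j) (flowDomain χ Vb a hh j) x (0, v)‖ ≤ M * χ (j + 1) * Vb (j + 1) 0 ^ 2 * ‖v‖
  /-- (1.13): `‖D_Vρ_j(x_j)‖_{L(𝒱,X_{j+1})} ≤ Mχ_{j+1}ḡ_{j+1}²`. -/
  dV_ρ_le : ∀ j, ∀ x ∈ flowDomain χ Vb a hh j, ∀ v : V3,
    ‖fderivWithin ℝ (ρ j) (flowDomain χ Vb a hh j) x (0, v)‖ ≤ M * χ (j + 1) * Vb (j + 1) 0 ^ 2 * ‖v‖
  /-- (1.13): the mixed derivatives of `ψ_j` of total order `2, 3`. -/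
  mixed_ψ : ∀ j, ∀ x ∈ flowDomain χ Vb a hh j,
    MixedDerivBound (ψ j) (flowDomain χ Vb a hh j) x M (χ (j + 1) * Vb (j + 1) 0 ^ 3)
      (Vb (j + 1) 0 ^ 2 * |Real.log (Vb (j + 1) 0)|)
  /-- (1.13): the mixed derivatives of `ρ_j` of total order `2, 3`. -/
  mixed_ρ : ∀ j, ∀ x ∈ flowDomain χ Vb a hh j,
    MixedDerivBound (ρ j) (flowDomain χ Vb a hh j) x M (χ (j + 1) * Vb (j + 1) 0 ^ 3)
      (Vb (j + 1) 0 ^ 2 * |Real.log (Vb (j + 1) 0)|)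

namespace HypA3

variable {χ : ℕ → ℝ} {ψ : ∀ j, W j × V3 → W (j + 1)} {ρ : ∀ j, W j × V3 → V3} {Vb : ℕ → V3}
  {a hh κ Ω R M : ℝ} (hA : HypA3 χ ψ ρ Vb a hh κ Ω R M)
include hA

/-- **[BBS-rg-flow, Lemma 3.3, first-derivative part for `ψ`]** in unscaled form: on `D_j`,
`‖ψ_j(K,V) - ψ_j(K',V')‖ ≤ κ‖K - K'‖ + Mχ_{j+1}ḡ_{j+1}²‖V - V'‖` ((1.12)–(1.13) and the mean value
inequality on the convex set `D_j`). [cite: BauerschmidtBrydgesSlade2015Flow, Lemma 3.3, (3.10) (proof) and Assumption (A3), (1.12)–(1.13)] -/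
theorem norm_ψ_sub_ψ_le (hχ : ∀ j, 0 ≤ χ j) (j : ℕ) {x x' : W j × V3}
    (hx : x ∈ flowDomain χ Vb a hh j) (hx' : x' ∈ flowDomain χ Vb a hh j) :
    ‖ψ j x - ψ j x'‖ ≤ κ * ‖x.1 - x'.1‖ + M * χ (j + 1) * Vb (j + 1) 0 ^ 2 * ‖x.2 - x'.2‖ := by
  have hM := hA.M_pos.le; have := hχ (j + 1)
  exact norm_sub_le_of_fderivWithin_dir (fun hx hx' => mixed_mem_flowDomain hx hx')
    (convex_flowDomain_sliceK χ Vb a hh j) (convex_flowDomain_sliceV χ Vb a hh j)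
    ((hA.contDiffOn_ψ j).differentiableOn (by norm_num)) hA.κ_pos.le (by positivity)
    (hA.dK_ψ_le j) (hA.dV_ψ_le j) hx hx'

/-- **[BBS-rg-flow, Lemma 3.3, first-derivative part for `ρ`]** in unscaled form: on `D_j`,
`‖ρ_j(K,V) - ρ_j(K',V')‖ ≤ M‖K - K'‖ + Mχ_{j+1}ḡ_{j+1}²‖V - V'‖`.
[cite: BauerschmidtBrydgesSlade2015Flow, Lemma 3.3, (3.10) (proof) and Assumption (A3), (1.12)–(1.13)] -/
theorem norm_ρ_sub_ρ_le (hχ : ∀ j, 0 ≤ χ j) (j : ℕ) {x x' : W j × V3}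
    (hx : x ∈ flowDomain χ Vb a hh j) (hx' : x' ∈ flowDomain χ Vb a hh j) :
    ‖ρ j x - ρ j x'‖ ≤ M * ‖x.1 - x'.1‖ + M * χ (j + 1) * Vb (j + 1) 0 ^ 2 * ‖x.2 - x'.2‖ := by
  have hM := hA.M_pos.le; have := hχ (j + 1)
  exact norm_sub_le_of_fderivWithin_dir (fun hx hx' => mixed_mem_flowDomain hx hx')
    (convex_flowDomain_sliceK χ Vb a hh j) (convex_flowDomain_sliceV χ Vb a hh j)
    ((hA.contDiffOn_ρ j).differentiableOn (by norm_num)) hM (by positivity)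
    (hA.dK_ρ_le j) (hA.dV_ρ_le j) hx hx'

/-- `‖ψ_j(K, V)‖ ≤ Rχ_{j+1}ḡ_{j+1}³ + κ‖K‖` for `(K,V) ∈ D_j` with `(0,V) ∈ D_j` (triangle inequality +
(1.11) + the `𝒦`-Lipschitz bound), the first display of the proof of Lemma 1.3.
[cite: BauerschmidtBrydgesSlade2015Flow, Lemma 1.3 (proof, first display)] -/
theorem norm_ψ_le (hχ : ∀ j, 0 ≤ χ j) (j : ℕ) {x : W j × V3} (hx : x ∈ flowDomain χ Vb a hh j)
    (hx0 : ((0 : W j), x.2) ∈ flowDomain χ Vb a hh j) :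
    ‖ψ j x‖ ≤ R * χ (j + 1) * Vb (j + 1) 0 ^ 3 + κ * ‖x.1‖ := by
  have h1 := hA.ψ_zero_le j x hx
  have h2 := hA.norm_ψ_sub_ψ_le hχ j hx hx0
  simp only [sub_zero, sub_self, norm_zero, mul_zero, add_zero] at h2
  calc ‖ψ j x‖ = ‖ψ j (0, x.2) + (ψ j x - ψ j (0, x.2))‖ := by rw [add_sub_cancel]
    _ ≤ ‖ψ j (0, x.2)‖ + ‖ψ j x - ψ j (0, x.2)‖ := norm_add_le _ _
    _ ≤ _ := add_le_add h1 h2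

end HypA3

/-- **[BBS-rg-flow, Lemma 1.3] (domain compatibility)**, quantitative form: assume (A3), `0 ≤ a_* ≤ a`,
`χ, ḡ ≥ 0`, the one-step weight ratio `χ_jḡ_j³ ≤ ϑχ_{j+1}ḡ_{j+1}³` (`ϑ = Ω(1+O(g₀))`,
`weight_cube_le_mul_succ`) and the smallness `R + κa_*ϑ ≤ a_*` (which holds for `g₀` small because
`a_* > R/(1-κΩ)`). If `‖K₀‖ ≤ a_*χ₀ḡ₀³` then `‖K̄_j‖ ≤ a_*χ_jḡ_j³` for all `j`, i.e.
`ψ_j(D_j(a_*)) ⊆ π_K D_{j+1}(a_*)` along `x̄`. [cite: BauerschmidtBrydgesSlade2015Flow, Lemma 1.3] -/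
theorem HypA3.norm_Kbar_le {χ : ℕ → ℝ} {ψ : ∀ j, W j × V3 → W (j + 1)} {ρ : ∀ j, W j × V3 → V3}
    {Vb : ℕ → V3} {a hh κ Ω R M : ℝ} (hA : HypA3 χ ψ ρ Vb a hh κ Ω R M) (hχ : ∀ j, 0 ≤ χ j)
    (hg : ∀ j, 0 ≤ Vb j 0) (hh0 : 0 ≤ hh) {aStar ϑ : ℝ} (ha0 : 0 ≤ aStar) (haa : aStar ≤ a)
    (hratio : ∀ j, χ j * Vb j 0 ^ 3 ≤ ϑ * (χ (j + 1) * Vb (j + 1) 0 ^ 3))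
    (hsmall : R + κ * aStar * ϑ ≤ aStar) {K₀ : W 0} (hK₀ : ‖K₀‖ ≤ aStar * χ 0 * Vb 0 0 ^ 3) (j : ℕ) :
    ‖Kbar ψ Vb K₀ j‖ ≤ aStar * χ j * Vb j 0 ^ 3 := by
  induction j with
  | zero => simpa using hK₀
  | succ j ih =>
    have ha : 0 ≤ a := ha0.trans haa
    have hxS : (Kbar ψ Vb K₀ j, Vb j) ∈ flowDomain χ Vb aStar hh j := by
      refine ⟨ih, ?_⟩
      have h0 := (zero_flow_mem_flowDomain (E := W j) ha0 hh0 hχ hg j).2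
      simpa using h0
    have hx : (Kbar ψ Vb K₀ j, Vb j) ∈ flowDomain χ Vb a hh j := flowDomain_mono haa hχ hg j hxS
    have hx0 : ((0 : W j), Vb j) ∈ flowDomain χ Vb a hh j := zero_flow_mem_flowDomain ha hh0 hχ hg j
    have h1 := hA.norm_ψ_le hχ j hx hx0
    rw [Kbar_succ]
    have hκ := hA.κ_pos.le
    have hw : 0 ≤ χ (j + 1) * Vb (j + 1) 0 ^ 3 := by have := hχ (j + 1); have := hg (j + 1); positivity
    calc ‖ψ j (Kbar ψ Vb K₀ j, Vb j)‖ ≤ R * χ (j + 1) * Vb (j + 1) 0 ^ 3 + κ * ‖Kbar ψ Vb K₀ j‖ := h1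
      _ ≤ R * χ (j + 1) * Vb (j + 1) 0 ^ 3 + κ * (aStar * (ϑ * (χ (j + 1) * Vb (j + 1) 0 ^ 3))) := by
          gcongr
          calc ‖Kbar ψ Vb K₀ j‖ ≤ aStar * χ j * Vb j 0 ^ 3 := ih
            _ = aStar * (χ j * Vb j 0 ^ 3) := by ring
            _ ≤ aStar * (ϑ * (χ (j + 1) * Vb (j + 1) 0 ^ 3)) := mul_le_mul_of_nonneg_left (hratio j) ha0
      _ = (R + κ * aStar * ϑ) * (χ (j + 1) * Vb (j + 1) 0 ^ 3) := by ring
      _ ≤ aStar * (χ (j + 1) * Vb (j + 1) 0 ^ 3) := mul_le_mul_of_nonneg_right hsmall hw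
      _ = _ := by ring

end SystemA3


end CTWSAW

end Literature.Barriers.CriticalPhenomena
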